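import Summits.CriticalPhenomena.PercolationContinuityZ3.Theorems.Transplant.SkelConcParamsAtQ
import HarnessLib

/-!
# L7.5c: the (R)-SIDE UNPACKING at the concrete generic choices — the root tube `Rt := F 1 − L' − 1` of p2-g4's
# `Skel.rootOblA_of_rootRunSG` (one unit below the product's, SkelConcRootRun), its radius facts (`60 r ≤ Rt`, `E₀ ≤ Rt`, `L' ≤ Rt`,
# `Rex q (E₀+1) ≤ Rt − L'`, `ψ M ≤ Rt`, `ψ (6t) ≤ Rt`), the root schedule numerics (`M + 47 R' + 2 ≤ t`, `2 R' + M + 1 ≤ t`, `t + R' ≤ 6t`), the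
# root route scales `ℓ ∈ [M+1, t+R']` inside the input family, and the first-hop facts (`ψ m + 1 ≤ E₀` for every scale `m ≤ 6t`) — generic twin of
# `BoxProdZ2ConcParamsRoot` (p227196) against the (R) hypothesis list of p2-g4 (20:44:01Z)

builds on p205010 (kernel theorem, internal audit signed; external expert review pending) — nothing in this file uses p205010.
Status sentence (coordinator 2026-08-20T04:30Z): "θ(p_c) = 0 on ℤ^d, all d ≥ 2 — kernel-verified (Lean 4/Mathlib, standard axioms); internal adversarial
audit SIGNED 2026-08-20 04:29Z; external expert review pending."
Lane `prim-bschramm-*`, seat `prim-bschramm-stmt` (gen 7); helper file (`--supports stmt-CriticalPhenomena-4575`).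
[cite: KozmaNitzan2024, §4 Theorem 6 (pp. 25–31), p. 27 (G₀), p. 28 ((32) at the root)]
-/

noncomputable section

open MeasureTheory
open scoped Classical

namespace Summit.CriticalPhenomena.PercolationContinuityZ3.Theorems

namespace Transplant

namespace SkelConc

open Literature.Probability.Percolation Literature.Probability.LatticeModels SimpleGraph KNCells KNLevels
open Literature.Probability.Percolation.GM (HOct)
open BoxProdZ2 (ConcRadiiG Erad Frad δmin δmin_pos nQ Erad_succ Frad_succ)

namespace Conc

/-! ## Planar numerics of the root run -/

section Consts

variable {κ : Consts} {V : Type} [Countable V] {G : SimpleGraph V} [G.LocallyFinite] {Φ : PlanarSkeletonConc G}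
  {p : unitInterval} {hC : Φ.toPlanarSkeleton.CylSubcritical p} {δA : ℝ} {M : ℕ}

/-- `M < R'` (indeed `8 M + 13 ≤ R'`). [folklore] -/
theorem lt_R'c : M < R'c κ Φ p hC δA M := by rw [R'c_eq]; omega

/-- `2000 (R' + 1) ≤ t` (`t = K · 100 (R'+1)`, `K ≥ 20`). [folklore] -/
theorem R'c_succ_le_tc' : 2000 * (R'c κ Φ p hC δA M + 1) ≤ tc κ Φ p hC δA M := by
  have hK := BoxProdZ2.twenty_le_Kof κ.K₀
  rw [tc_eq]; nlinarith

/-- `t + R' ≤ 6 t` (the root's route scales lie below the top scale `6t`). [folklore] -/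
theorem tc_add_R'c_le : tc κ Φ p hC δA M + R'c κ Φ p hC δA M ≤ 6 * tc κ Φ p hC δA M := by
  have h := R'c_succ_le_tc' (κ := κ) (Φ := Φ) (p := p) (hC := hC) (δA := δA) (M := M); omega

/-- **The root schedule's numerics**: `m + 47 R' + 2 ≤ t` for every first-hop scale `m ≤ R'` (in particular `m := M`). [folklore] -/
theorem root_arith {m : ℕ} (hm : m ≤ R'c κ Φ p hC δA M) : m + 47 * R'c κ Φ p hC δA M + 2 ≤ tc κ Φ p hC δA M := by
  have h := R'c_succ_le_tc' (κ := κ) (Φ := Φ) (p := p) (hC := hC) (δA := δA) (M := M); omega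

/-- `M + 47 R' + 2 ≤ t`. [folklore] -/
theorem root_arith_M : M + 47 * R'c κ Φ p hC δA M + 2 ≤ tc κ Φ p hC δA M := root_arith lt_R'c.le

/-- `2 R' + M + 1 ≤ t`. [folklore] -/
theorem two_R'c_le : 2 * R'c κ Φ p hC δA M + M + 1 ≤ tc κ Φ p hC δA M := by
  have h := R'c_succ_le_tc' (κ := κ) (Φ := Φ) (p := p) (hC := hC) (δA := δA) (M := M)
  have h' := lt_R'c (κ := κ) (Φ := Φ) (p := p) (hC := hC) (δA := δA) (M := M)
  omega

/-- `M + 1 ≤ M + L` (`0 < L`). [folklore] -/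
theorem hMR (h0 : 0 < δA) (hp0 : 0 < (p : ℝ)) (hp1 : (p : ℝ) < 1) : M + 1 ≤ M + Lc κ Φ p hC δA M := by
  have := Lc_pos (κ := κ) (Φ := Φ) (hC := hC) (M := M) h0 hp0 hp1; omega

/-- `ψ (t + R') ≤ ψ (6 t)`. [folklore] -/
theorem ψ_mid_le : ψ Φ p hC (tc κ Φ p hC δA M + R'c κ Φ p hC δA M) ≤ ψ Φ p hC (6 * tc κ Φ p hC δA M) := ψ_mono tc_add_R'c_le

/-- `M ≤ 6 t`. [folklore] -/
theorem le_six_tc : M ≤ 6 * tc κ Φ p hC δA M := lt_six_tc.le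

/-- The root route scales `[M+1, t+R']` lie in the scale set. [folklore] -/
theorem Icc_root_subset_Sc : Finset.Icc (M + 1) (tc κ Φ p hC δA M + R'c κ Φ p hC δA M) ⊆ Sc κ Φ p hC δA M :=
  fun _ hℓ => mem_Sc_of ((Nat.le_succ M).trans (Finset.mem_Icc.1 hℓ).1) ((Finset.mem_Icc.1 hℓ).2.trans tc_add_R'c_le)

end Consts

/-! ## The root tube `Rt = F 1 − L' − 1` -/

section Root

variable {κ : Consts} {V : Type} [Countable V] {G : SimpleGraph V} [G.LocallyFinite] {Φ : PlanarSkeletonConc G}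
  {p : unitInterval} {hC : Φ.toPlanarSkeleton.CylSubcritical p} {δA : ℝ} {M : ℕ} {q : unitInterval}

/-- **The root tube radius**: `Rt := F 1 − L' − 1` (p2-g4: spans strictly deeper than `Rt` lie in the between-box / the child's cube / target).
[this work] -/
def Rt (κ : Consts) {V : Type} [Countable V] {G : SimpleGraph V} [G.LocallyFinite] (Φ : PlanarSkeletonConc G) (p : unitInterval)
    (hC : Φ.toPlanarSkeleton.CylSubcritical p) (δA : ℝ) (M : ℕ) (q : unitInterval) : ℕ :=
  Frad (gapc κ Φ p hC δA M q) (fun _ => 0) (E₀c κ Φ p hC δA M q) 1 - L'c κ Φ p hC δA M q - 1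

/-- `Rt = E₀ + L' + Rex q (E₀ + 1) + 100 r`. [folklore] -/
theorem Rt_eq : Rt κ Φ p hC δA M q =
    E₀c κ Φ p hC δA M q + L'c κ Φ p hC δA M q + Rexc κ Φ p hC δA M q (E₀c κ Φ p hC δA M q + 1) + 100 * (Cc κ Φ p hC δA M).r := by
  unfold Rt; rw [hRt]; omega

/-- `F 1 = E₀ + gap E₀` and `L' + 1 ≤ F 1`. [folklore] -/
theorem L'_succ_le_F_one : L'c κ Φ p hC δA M q + 1 ≤ Frad (gapc κ Φ p hC δA M q) (fun _ => 0) (E₀c κ Φ p hC δA M q) 1 := by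
  have h := hRt (κ := κ) (Φ := Φ) (p := p) (hC := hC) (δA := δA) (M := M) (q := q); omega

/-- `Rt + 1 = F 1 − L'` (no truncation). [folklore] -/
theorem Rt_succ : Rt κ Φ p hC δA M q + 1 = Frad (gapc κ Φ p hC δA M q) (fun _ => 0) (E₀c κ Φ p hC δA M q) 1 - L'c κ Φ p hC δA M q := by
  have h := hRt (κ := κ) (Φ := Φ) (p := p) (hC := hC) (δA := δA) (M := M) (q := q); unfold Rt; omega

/-- `60 r ≤ Rt` (the planar root corridor reaches depth `≤ 60 r`; from the `100 r` drift). [folklore] -/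
theorem sixty_r_le_Rt : 60 * (Cc κ Φ p hC δA M).r ≤ Rt κ Φ p hC δA M q := by rw [Rt_eq]; omega

/-- `E₀ ≤ Rt`. [folklore] -/
theorem E₀_le_Rt : E₀c κ Φ p hC δA M q ≤ Rt κ Φ p hC δA M q := by rw [Rt_eq]; omega

/-- `L' ≤ Rt`. [folklore] -/
theorem L'_le_Rt : L'c κ Φ p hC δA M q ≤ Rt κ Φ p hC δA M q := by rw [Rt_eq]; omega

/-- **The root's rim excess fits**: `Rex q (E₀ + 1) ≤ Rt − L'` (entrances from the wired root cube at depth `≤ E₀ + 1`). [folklore] -/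
theorem Rex_le_Rt_sub : Rexc κ Φ p hC δA M q (E₀c κ Φ p hC δA M q + 1) ≤ Rt κ Φ p hC δA M q - L'c κ Φ p hC δA M q := by
  rw [Rt_eq]; omega

/-- `ψ M ≤ Rt`. [folklore] -/
theorem ψ_le_Rt : ψ Φ p hC M ≤ Rt κ Φ p hC δA M q := ψ_le_E₀.trans E₀_le_Rt

/-- `ψ (6 t) ≤ Rt` (every first-hop scale `≤ 6t` has its fat prism inside the root tube). [folklore] -/
theorem ψ_top_le_Rt : ψ Φ p hC (6 * tc κ Φ p hC δA M) ≤ Rt κ Φ p hC δA M q := ψ_top_le_E₀.trans E₀_le_Rt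

/-- **`hL` for the root's tube chains**: `ψ (t + R') + ψ M ≤ L'`. [folklore] -/
theorem hL_root : ψ Φ p hC (tc κ Φ p hC δA M + R'c κ Φ p hC δA M) + ψ Φ p hC M ≤ L'c κ Φ p hC δA M q :=
  le_trans (Nat.add_le_add_right ψ_mid_le _) (by have h := hL_reach (κ := κ) (Φ := Φ) (p := p) (hC := hC) (δA := δA) (M := M) (q := q); omega)

/-- `rQ 0 0 = E₀` for the generic schedule (the max with `off 0 = 1` is inactive: `1 ≤ E₀`). [folklore] -/
theorem rQ_zero_zero : (Λc κ Φ p hC δA M q).rQ 0 0 = E₀c κ Φ p hC δA M q := by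
  rw [Λc_eq, Skel.concRadiiS_rQ]
  have h1 : 1 ≤ E₀c κ Φ p hC δA M q := one_le_E₀
  have hoff : Skel.off (Cc κ Φ p hC δA M) 0 = 1 := by simp [Skel.off]
  rw [hoff]
  simp only [nQ, if_true, BoxProdZ2.gen0_zero, Erad]
  exact max_eq_left h1

/-- **The wired root cube contains every first-hop seed**: `ψ m + 1 ≤ E₀` for every scale `m ≤ 6 t`. [folklore] -/
theorem ψ_succ_le_E₀ {m : ℕ} (hm : m ≤ 6 * tc κ Φ p hC δA M) : ψ Φ p hC m + 1 ≤ E₀c κ Φ p hC δA M q := by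
  have h1 : ψ Φ p hC m ≤ ψ Φ p hC (6 * tc κ Φ p hC δA M) := ψ_mono hm
  have h2 := hL_reach (κ := κ) (Φ := Φ) (p := p) (hC := hC) (δA := δA) (M := M) (q := q)
  have h3 := L'_le_E₀ (κ := κ) (Φ := Φ) (p := p) (hC := hC) (δA := δA) (M := M) (q := q)
  have ht : 1 ≤ tc κ Φ p hC δA M := le_trans (by omega) (R'c_succ_le_tc (κ := κ) (Φ := Φ) (p := p) (hC := hC) (δA := δA) (M := M))
  omega

/-- `1 ≤ t`. [folklore] -/
theorem one_le_tc : 1 ≤ tc κ Φ p hC δA M :=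
  le_trans (by omega) (R'c_succ_le_tc (κ := κ) (Φ := Φ) (p := p) (hC := hC) (δA := δA) (M := M))

/-- **First hop** (p2-g4 21:45:48Z, `R₀ := 40 t + ψ M`): `40 t + ψ M + 1 ≤ E₀ (= rQ 0 0)`. [folklore] -/
theorem firstHop_R₀_succ_le_E₀ : 40 * tc κ Φ p hC δA M + ψ Φ p hC M + 1 ≤ E₀c κ Φ p hC δA M q := by
  have h1 := hL_reach (κ := κ) (Φ := Φ) (p := p) (hC := hC) (δA := δA) (M := M) (q := q)
  have h2 := hr (κ := κ) (Φ := Φ) (p := p) (hC := hC) (δA := δA) (M := M)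
  have h3 := one_le_tc (κ := κ) (Φ := Φ) (p := p) (hC := hC) (δA := δA) (M := M)
  unfold E₀c; omega

/-- **First hop**: `40 t + ψ (6 t) + 2 ≤ E₀` (the top-scale link prism and the seed inside the wired root cube). [folklore] -/
theorem firstHop_top_le_E₀ : 40 * tc κ Φ p hC δA M + ψ Φ p hC (6 * tc κ Φ p hC δA M) + 2 ≤ E₀c κ Φ p hC δA M q := by
  have h1 := hL_reach (κ := κ) (Φ := Φ) (p := p) (hC := hC) (δA := δA) (M := M) (q := q)
  have h2 := hr (κ := κ) (Φ := Φ) (p := p) (hC := hC) (δA := δA) (M := M)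
  have h3 := one_le_tc (κ := κ) (Φ := Φ) (p := p) (hC := hC) (δA := δA) (M := M)
  unfold E₀c; omega

/-- **First hop**: `40 t + ψ (6 t) ≤ Rt` and `40 t + ψ M ≤ Rt` (`R₀ ≤ Rt`). [folklore] -/
theorem firstHop_le_Rt : 40 * tc κ Φ p hC δA M + ψ Φ p hC (6 * tc κ Φ p hC δA M) ≤ Rt κ Φ p hC δA M q ∧
    40 * tc κ Φ p hC δA M + ψ Φ p hC M ≤ Rt κ Φ p hC δA M q := by
  have h1 := firstHop_top_le_E₀ (κ := κ) (Φ := Φ) (p := p) (hC := hC) (δA := δA) (M := M) (q := q)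
  have h2 := firstHop_R₀_succ_le_E₀ (κ := κ) (Φ := Φ) (p := p) (hC := hC) (δA := δA) (M := M) (q := q)
  have h3 := E₀_le_Rt (κ := κ) (Φ := Φ) (p := p) (hC := hC) (δA := δA) (M := M) (q := q)
  exact ⟨by omega, by omega⟩

/-- The first-hop seed box fits the root cell: `M + 1 ≤ 17 t` (indeed `M < R' < t`). [folklore] -/
theorem M_succ_le_17t : M + 1 ≤ 17 * tc κ Φ p hC δA M := by
  have h := two_R'c_le (κ := κ) (Φ := Φ) (p := p) (hC := hC) (δA := δA) (M := M); omega

/-- `Rex q (E g + 1) + 100 r + L' ≤ E (g+1) − 0` restated as `Rex q (E g + 1) ≤ E (g+1) − L'` (rim excess one level up). [folklore] -/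
theorem Rex_le_Erad_sub (g : ℕ) :
    Rexc κ Φ p hC δA M q (Erad (gapc κ Φ p hC δA M q) (fun _ => 0) (E₀c κ Φ p hC δA M q) g + 1) ≤
      Erad (gapc κ Φ p hC δA M q) (fun _ => 0) (E₀c κ Φ p hC δA M q) (g + 1) - L'c κ Φ p hC δA M q := by
  have h := hsch (κ := κ) (Φ := Φ) (p := p) (hC := hC) (δA := δA) (M := M) (q := q) g; omega

end Root

/-! ## The root's inputs at the running parameter -/

section AtQ

variable {κ : Consts} {V : Type} [DecidableEq V] [Countable V] {G : SimpleGraph V} [G.LocallyFinite] {Φ : PlanarSkeletonConc G} {t : V}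
  {p : unitInterval} {hC : Φ.toPlanarSkeleton.CylSubcritical p} {δA : ℝ} {hδA : 0 < δA} {msel : V → ℕ} {M : ℕ} {q : unitInterval}
  (hat : (choiceAt κ Φ t p hC hδA).AtQ msel M q)
include hat

/-- **`hlink` at the root route scales `ℓ ∈ [M+1, t+R']`** at any accuracy `a ≥ δmin`, at every base vertex. [folklore] -/
theorem hlink_root_at {a : ℝ} (ha : δmin (κ.prod Φ.Δ) nR δA ≤ a) : ∀ ℓ, M + 1 ≤ ℓ → ℓ ≤ tc κ Φ p hC δA M + R'c κ Φ p hC δA M →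
    ∀ τ ∈ Φ.types, ∀ g : HOct 2, 1 - a ^ 2 < (bondPercolation G q).real
      (linkIn (↑(Skel.fatSeq Φ hC τ ℓ)) (Skel.fatSeq Φ hC τ (msel τ)) (Skel.macroPiece Φ τ ℓ (Skel.fatRadius Φ hC ℓ) g)) :=
  fun ℓ h₁ h₂ => hlink_at hat ha ℓ h₁ (h₂.trans tc_add_R'c_le)

/-- **The standard estimates at any first-hop scale `m ∈ [M, 6t]`** at any accuracy `a ≥ δmin` (zone + eight links at every base vertex).
[folklore] -/
theorem hstd_hop_at {a : ℝ} (ha : δmin (κ.prod Φ.Δ) nR δA ≤ a) {m : ℕ} (h₁ : M ≤ m) (h₂ : m ≤ 6 * tc κ Φ p hC δA M) : ∀ τ ∈ Φ.types,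
    1 - a ^ 2 < (bondPercolation G q).real (UniqZone.zone G (Skel.fatSeq Φ hC τ) (msel τ) m) ∧
      ∀ g : HOct 2, 1 - a ^ 2 < (bondPercolation G q).real
        (linkIn (↑(Skel.fatSeq Φ hC τ m)) (Skel.fatSeq Φ hC τ (msel τ)) (Skel.macroPiece Φ τ m (Skel.fatRadius Φ hC m) g)) :=
  hstd_at_scale hat ha h₁ h₂

end AtQ

end Conc

end SkelConc

end Transplant

end Summit.CriticalPhenomena.PercolationContinuityZ3.Theorems

end
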